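import Mathlib
import Literature.Barriers.ValiantsHypothesis.AlgebraicNaturalProofs
import Literature.Computability.AlgebraicComplexity.ArithCircuitProofs
import Summits.ValiantsHypothesis.ValiantsHypothesis.Theorems.BarrierLeverPartitionMinorsHitByVPProductStatesGeneral

/-!
# Route BarrierLever — item `PartitionMinorsHitByVP` (stmt-ValiantsHypothesis-19717):
# TRANSVECTION layouts — a linear image beyond the cube automorphisms is hit by two product states

Helper file (`--supports stmt-ValiantsHypothesis-19717`; cell valiant-natproofs, rung V4, 𝒟-side,
prover seat val-np-p6 gen 2). Definition-free, outside the theses cone. Closes NO item.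

The automorphic layouts `W = σ(U ∆ s)` (p437176; cube automorphisms = coordinate permutations and
translations, the hyperoctahedral group) are hit by ONE twisted diagonal product state. Identify sets
with vectors of `𝔽₂^h`; the next simplest linear maps are the TRANSVECTIONS
`g_{a,b} : e_a ↦ e_a + e_b` (`a ≠ b`), i.e. `g(U) = U` if `a ∉ U` and `g(U) = U ∆ {b}` if `a ∈ U` —
NOT cube automorphisms (they do not preserve Hamming distances). The layout `(U, g(U))` is hit by the
SUM OF TWO product states
`f = Π_{c ≠ a}(1 + x_c y_c) + x_a y_a (x_b + y_b) Π_{c ≠ a,b}(1 + x_c y_c) = Σ_S x^S y^{g(S)}`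
(size `O(h)`, inside `SmallCircuits ℂ (h+h) 3` for `h ≥ 4` by
`…ProductStatesC.twoProdStatesC_mem_smallCircuits`): its layout matrix on `(U, g U)` is the identity.

* `transvection_entry` — the `(U, g U')` coefficient of `f` is `[U = U']`.
* **`partitionMinor_hit_of_transvection`** (UNCONDITIONAL CLASS, `b = 3`, `h ≥ 4`): `w (e i) = g(u i)`
  for a transvection `g = g_{a,b}` and a matching permutation `e` ⇒ hit.

Compositions: a product of `k` transvections with pairwise disjoint supports is hit by `2^k` product
states the same way (affordable for `k = O(log h)`); whether `(U, gU)` is hit for every `g ∈ GL_h(𝔽₂)`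
is OPEN here (composition of coefficient patterns is a contraction of partition matrices, not a cheap
circuit operation).

WHAT THIS IS NOT: a thin structured class; nothing on the middle band, on TT / 19616 / 19761, on crux
14610 or on VP vs VNP.
-/

set_option linter.dupNamespace false

namespace Summit.ValiantsHypothesis.ValiantsHypothesis.Theorems.BarrierLever.StrataDoor

open Finset MvPolynomial
open Literature.Barriers.ValiantsHypothesis Literature.Computability.AlgebraicComplexity
open Summit.ValiantsHypothesis.ValiantsHypothesis.Theorems.BarrierLever.ProductStatesC
  (coeff_prodStateC twoProdStatesC_mem_smallCircuits)

variable {h r : ℕ}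

/-- A product of indicators is the indicator of the conjunction. -/
theorem prod_indicator_eq (P : Fin h → Prop) [DecidablePred P] :
    (∏ c : Fin h, (if P c then (1 : ℂ) else 0)) = if (∀ c, P c) then 1 else 0 := by
  rw [Finset.prod_boole]
  simp

/-- **The transvection coefficient pattern.** With the site tables of the two product states
(`a`-site constant `1` / all other sites `1 + x y`) and (`a`-site `x y` / `b`-site `x + y` / other sites
`1 + x y`), the `(U, g U')` entry is `[U = U']`, where `g U' = U' ∆ {b}` if `a ∈ U'`, else `U'`. -/
theorem transvection_entry (a b : Fin h) (hab : a ≠ b) (U U' : Finset (Fin h)) :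
    ((∏ c : Fin h, (if ((c = a → (decide (c ∈ U) = false ∧
          decide (c ∈ (if a ∈ U' then symmDiff U' {b} else U')) = false)) ∧
        (c ≠ a → decide (c ∈ U) = decide (c ∈ (if a ∈ U' then symmDiff U' {b} else U'))))
        then (1 : ℂ) else 0)) +
      ∏ c : Fin h, (if ((c = a → (decide (c ∈ U) = true ∧
          decide (c ∈ (if a ∈ U' then symmDiff U' {b} else U')) = true)) ∧
        (c = b → (decide (c ∈ U) = true ↔
          decide (c ∈ (if a ∈ U' then symmDiff U' {b} else U')) = false)) ∧
        ((c ≠ a ∧ c ≠ b) → decide (c ∈ U) = decide (c ∈ (if a ∈ U' then symmDiff U' {b} else U'))))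
        then (1 : ℂ) else 0)) = if U = U' then 1 else 0 := by
  classical
  rw [prod_indicator_eq, prod_indicator_eq]
  simp only [decide_eq_false_iff_not, decide_eq_true_iff, decide_eq_decide]
  by_cases haU' : a ∈ U'
  · -- `g U' = U' ∆ {b}`, which contains `a`: the first product vanishes, the second tests `U = U'`
    simp only [if_pos haU']
    have haW : a ∈ symmDiff U' {b} := by
      rw [Finset.mem_symmDiff, Finset.mem_singleton]; exact Or.inl ⟨haU', hab⟩
    have hmemW : ∀ c, c ∈ symmDiff U' {b} ↔ ((c ∈ U' ∧ c ≠ b) ∨ (c = b ∧ c ∉ U')) := by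
      intro c; rw [Finset.mem_symmDiff, Finset.mem_singleton]
    rw [if_neg (fun hall => ((hall a).1 rfl).2 haW), zero_add]
    by_cases hUU : U = U'
    · subst hUU
      rw [if_pos rfl, if_pos]
      intro c
      refine ⟨fun hca => ⟨hca ▸ haU', hca ▸ haW⟩, fun hcb => ?_, fun hc => ?_⟩
      · subst hcb; rw [hmemW]; tauto
      · rw [hmemW]; tauto
    · rw [if_neg hUU, if_neg]
      intro hall
      apply hUU
      ext c
      by_cases hca : c = a
      · subst hca; exact ⟨fun _ => haU', fun _ => ((hall c).1 rfl).1⟩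
      · by_cases hcb : c = b
        · subst hcb
          have := (hall c).2.1 rfl
          rw [hmemW] at this
          tauto
        · have := (hall c).2.2 ⟨hca, hcb⟩
          rw [hmemW] at this
          tauto
  · -- `g U' = U'`, which avoids `a`: the second product vanishes, the first tests `U = U'`
    simp only [if_neg haU']
    have h2 : ¬ (∀ c, (c = a → c ∈ U ∧ c ∈ U') ∧ (c = b → (c ∈ U ↔ c ∉ U')) ∧
        (c ≠ a ∧ c ≠ b → (c ∈ U ↔ c ∈ U'))) := fun hall => haU' ((hall a).1 rfl).2
    rw [if_neg h2, add_zero]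
    by_cases hUU : U = U'
    · subst hUU
      rw [if_pos rfl, if_pos]
      intro c
      exact ⟨fun hca => ⟨hca ▸ haU', hca ▸ haU'⟩, fun _ => Iff.rfl⟩
    · rw [if_neg hUU, if_neg]
      intro hall
      apply hUU
      ext c
      by_cases hca : c = a
      · subst hca; exact ⟨fun hc => absurd hc ((hall c).1 rfl).1, fun hc => absurd hc haU'⟩
      · exact (hall c).2 hca

/-- **Transvection layouts are hit** (`b = 3`, `h ≥ 4`): if `w (e i) = g_{a,b}(u i)` for all `i`
(`g_{a,b}(U) = U ∆ {b}` if `a ∈ U`, else `U`; `a ≠ b`; `e` a permutation of `Fin r`), then the sum of the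
two product states of the module docstring, a member of `SmallCircuits ℂ (h+h) 3`, makes the layout
matrix of item 19717 nonsingular. -/
theorem partitionMinor_hit_of_transvection (hh : 4 ≤ h) (a b : Fin h) (hab : a ≠ b)
    (u w : Fin r → Finset (Fin h)) (hu : Function.Injective u) (e : Equiv.Perm (Fin r))
    (hw : ∀ i, w (e i) = if a ∈ u i then symmDiff (u i) {b} else u i) :
    ∃ f ∈ SmallCircuits ℂ (h + h) 3,
      (Matrix.of fun i j : Fin r => MvPolynomial.coeff
        (∑ a' ∈ u i, Finsupp.single (Fin.castAdd h a') 1 +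
          ∑ c ∈ w j, Finsupp.single (Fin.natAdd h c) 1) f).det ≠ 0 := by
  classical
  -- site tables
  set m₁ : Fin h → Bool → Bool → ℂ := fun c p q =>
    if ((c = a → (p = false ∧ q = false)) ∧ (c ≠ a → p = q)) then 1 else 0 with hm₁
  set m₂ : Fin h → Bool → Bool → ℂ := fun c p q =>
    if ((c = a → (p = true ∧ q = true)) ∧ (c = b → (p = true ↔ q = false)) ∧
      ((c ≠ a ∧ c ≠ b) → p = q)) then 1 else 0 with hm₂
  set f : MvPolynomial (Fin (h + h)) ℂ :=
    C 1 * (∏ c, ∑ p : Bool × Bool, C (m₁ c p.1 p.2) * X (Fin.castAdd h c) ^ p.1.toNat *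
        X (Fin.natAdd h ((Equiv.refl (Fin h)) c)) ^ p.2.toNat) +
      C 1 * (∏ c, ∑ p : Bool × Bool, C (m₂ c p.1 p.2) * X (Fin.castAdd h c) ^ p.1.toNat *
        X (Fin.natAdd h ((Equiv.refl (Fin h)) c)) ^ p.2.toNat) with hf
  refine ⟨f, twoProdStatesC_mem_smallCircuits hh 1 1 m₁ m₂, ?_⟩
  -- entries against the permuted columns
  have hentry : ∀ i i' : Fin r, MvPolynomial.coeff
      (∑ a' ∈ u i, Finsupp.single (Fin.castAdd h a') 1 +
        ∑ c ∈ w (e i'), Finsupp.single (Fin.natAdd h c) 1) f = if i = i' then 1 else 0 := by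
    intro i i'
    rw [hf, coeff_add, coeff_C_mul, coeff_C_mul, one_mul, one_mul, coeff_prodStateC, coeff_prodStateC,
      hw i']
    simp only [hm₁, hm₂]
    have key := transvection_entry a b hab (u i) (u i')
    rw [show (if i = i' then (1 : ℂ) else 0) = (if u i = u i' then 1 else 0) from by
      simp only [hu.eq_iff]]
    exact key
  set M : Matrix (Fin r) (Fin r) ℂ := Matrix.of fun i j : Fin r => MvPolynomial.coeff
    (∑ a' ∈ u i, Finsupp.single (Fin.castAdd h a') 1 + ∑ c ∈ w j, Finsupp.single (Fin.natAdd h c) 1) f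
    with hM
  have hsub : M.submatrix id e = 1 := by
    ext i j
    rw [Matrix.submatrix_apply, hM, Matrix.of_apply, id, hentry, Matrix.one_apply]
  have hdet : (M.submatrix id e).det = 1 := by rw [hsub, Matrix.det_one]
  rw [Matrix.det_permute'] at hdet
  intro h0
  rw [h0, mul_zero] at hdet
  exact zero_ne_one hdet

end Summit.ValiantsHypothesis.ValiantsHypothesis.Theorems.BarrierLever.StrataDoor
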